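import Mathlib
import HarnessLib
import Literature.MathematicalPhysics.QuantumLattice.GrassmannEffectiveActionCopies
import Literature.MathematicalPhysics.QuantumLattice.GrassmannKernels
import Literature.Probability.LatticeModels.SubmultiplicativeTreeWeight

/-!
# Route `KLProgramme` — crux K3, the nested two-volume pass: PROFILES OF GLUED ELEMENTS AND OF DIFFERENCES (bookkeeping for the STEP's `hNV`/`hND`)
# (cell gate-hubbard-kl, seat hubbard-kl-k3c4-p1 g9; VL-INDUCTION-BLUEPRINT-g8.md (vi); `--supports` stmt-…-20440)

The two-volume STEP (`…TwoVolumeInductiveStep.sum_norm_kernel_twoVolume_step_le`) takes the `φ(diam_{d′})`-weighted pinned profile `NV` of the GLUED coarse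
action `Σ_β map (Fe β) V` on the fine labels `Γ′ ≃ ι × Γ` and the weighted profile `ND` of the defect `W′ − Σ_β map (Fe β) V`.  Both are ONE-volume numbers:

* `labelDiam_image_eq_of_isometry` / `diamWeight_image_eq_of_isometry` — diameters are invariant under a distance-preserving relabelling;
* **`sum_pinned_wt_norm_kernel_glue_eq`** — for a fine distance `d′` that restricts to the coarse distance `dc` inside every block
  (`d′ (e⁻¹(β,x)) (e⁻¹(β,y)) = dc x y`), the weighted pinned profile of the glued element at a fine pin `x′` EQUALS the weighted pinned profile of `V` at the
  coarse pin `(e x′).2` (glued kernels live in one block: `GrassmannEffectiveActionCopies.sum_pinned_kernel_copies_sum`); `…_le` against a bound; the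
  unweighted twin `sum_pinned_norm_kernel_glue_eq`;
* **`sum_pinned_wt_norm_kernel_sub_le`** — the weighted pinned profile of a difference is at most the sum of the two profiles (so `ND ≤ N_{W′} + N_V`).

Generic; everything proved; no definition.
-/

noncomputable section

namespace Summit.HubbardSuperconductivity.HubbardSuperconductivity.Theorems.TwoVolumeDefect

set_option linter.dupNamespace false -- summit = problem name (single-conjunct summit), D-0017

open Finset Literature.MathematicalPhysics.QuantumLattice GrassmannAlgebra Literature.Probability.LatticeModels
  Literature.Probability.LatticeModels.BattleFederbush

/-! ## §1 Diameters under a distance-preserving relabelling -/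

/-- **The diameter of an image under a distance-preserving map is the diameter.** [folklore] -/
theorem labelDiam_image_eq_of_isometry {Λ Λ' : Type*} [DecidableEq Λ'] (d : Λ → Λ → ℝ) (d' : Λ' → Λ' → ℝ) (f : Λ → Λ')
    (hf : ∀ a b, d' (f a) (f b) = d a b) (S : Finset Λ) : labelDiam d' (S.image f) = labelDiam d S := by
  refine le_antisymm (labelDiam_le d' (labelDiam_nonneg d S) fun a' ha' b' hb' => ?_)
    (labelDiam_le d (labelDiam_nonneg d' _) fun a ha b hb => ?_)
  · obtain ⟨a, ha, rfl⟩ := mem_image.1 ha'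
    obtain ⟨b, hb, rfl⟩ := mem_image.1 hb'
    rw [hf]
    exact le_labelDiam d ha hb
  · rw [← hf]
    exact le_labelDiam d' (mem_image_of_mem f ha) (mem_image_of_mem f hb)

/-- The diameter weight of an image under a distance-preserving map. [folklore] -/
theorem diamWeight_image_eq_of_isometry {Λ Λ' : Type*} [DecidableEq Λ'] (φ : ℝ → ℝ) (d : Λ → Λ → ℝ) (d' : Λ' → Λ' → ℝ) (f : Λ → Λ')
    (hf : ∀ a b, d' (f a) (f b) = d a b) (S : Finset Λ) : diamWeight φ d' (S.image f) = diamWeight φ d S := by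
  rw [diamWeight, diamWeight, labelDiam_image_eq_of_isometry d d' f hf]

/-! ## §2 Profiles of glued elements -/

variable {𝕜 : Type*} [RCLike 𝕜] {Γ ι : Type*} [Fintype Γ] [DecidableEq Γ] [Fintype ι] [DecidableEq ι]
  {Γ' : Type*} [Fintype Γ'] [DecidableEq Γ']

/-- **The weighted pinned profile of a glued element is the weighted pinned profile of one copy.**  With `e : Γ′ ≃ ι × Γ`, block embeddings
`Fe β v X′ = [blk X′ = β]·v(π X′)`, and a fine distance restricting to the coarse one inside blocks, for every degree `m`, leg `j` and fine pin `x′`: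
`Σ_{Y′ : Y′_j = x′} ‖kernel (Σ_β map (Fe β) V) m Y′‖·φ(diam_{d′} Y′) = Σ_{Y : Y_j = (e x′).2} ‖kernel V m Y‖·φ(diam_{dc} Y)`.
[cite: Salmhofer1999, Def. 2.19 (2.102)-(2.106)] -/
theorem sum_pinned_wt_norm_kernel_glue_eq (e : Γ' ≃ ι × Γ) (Fe : ι → (Γ → 𝕜) →ₗ[𝕜] (Γ' → 𝕜))
    (hFe : ∀ β v X', Fe β v X' = if (e X').1 = β then v (e X').2 else 0) (dc : Γ → Γ → ℝ) (d' : Γ' → Γ' → ℝ)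
    (hd' : ∀ (β : ι) (x y : Γ), d' (e.symm (β, x)) (e.symm (β, y)) = dc x y) (φ : ℝ → ℝ)
    (V : GrassmannAlgebra 𝕜 Γ) {m : ℕ} (j : Fin m) (x' : Γ') :
    ∑ Y' ∈ univ.filter (fun Y' : Fin m → Γ' => Y' j = x'),
        ‖kernel 𝕜 (∑ β, ExteriorAlgebra.map (Fe β) V) m Y'‖ * diamWeight φ d' (univ.image Y') =
      ∑ Y ∈ univ.filter (fun Y : Fin m → Γ => Y j = (e x').2), ‖kernel 𝕜 V m Y‖ * diamWeight φ dc (univ.image Y) := by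
  classical
  rw [sum_pinned_kernel_copies_sum e Fe hFe V j x' (fun Y' k => ‖k‖ * diamWeight φ d' (univ.image Y'))
    (fun Y' => by rw [norm_zero, zero_mul])]
  refine sum_congr rfl fun Y _ => ?_
  congr 1
  rw [show (univ.image fun i => e.symm ((e x').1, Y i)) = (univ.image Y).image (fun y => e.symm ((e x').1, y)) by
    rw [image_image]; rfl]
  exact diamWeight_image_eq_of_isometry φ dc d' _ (hd' (e x').1) _

/-- **Bound form**: a weighted pinned profile of `V` at every coarse pin bounds the weighted pinned profile of the glued element at every fine pin. [folklore] -/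
theorem sum_pinned_wt_norm_kernel_glue_le (e : Γ' ≃ ι × Γ) (Fe : ι → (Γ → 𝕜) →ₗ[𝕜] (Γ' → 𝕜))
    (hFe : ∀ β v X', Fe β v X' = if (e X').1 = β then v (e X').2 else 0) (dc : Γ → Γ → ℝ) (d' : Γ' → Γ' → ℝ)
    (hd' : ∀ (β : ι) (x y : Γ), d' (e.symm (β, x)) (e.symm (β, y)) = dc x y) (φ : ℝ → ℝ)
    (V : GrassmannAlgebra 𝕜 Γ) {m : ℕ} (j : Fin m) {N : ℝ}
    (hN : ∀ x : Γ, ∑ Y ∈ univ.filter (fun Y : Fin m → Γ => Y j = x), ‖kernel 𝕜 V m Y‖ * diamWeight φ dc (univ.image Y) ≤ N) (x' : Γ') :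
    ∑ Y' ∈ univ.filter (fun Y' : Fin m → Γ' => Y' j = x'),
        ‖kernel 𝕜 (∑ β, ExteriorAlgebra.map (Fe β) V) m Y'‖ * diamWeight φ d' (univ.image Y') ≤ N := by
  rw [sum_pinned_wt_norm_kernel_glue_eq e Fe hFe dc d' hd' φ V j x']
  exact hN _

/-- **Unweighted twin**: `Σ_{Y′ : Y′_j = x′} ‖kernel (Σ_β map (Fe β) V) m Y′‖ = Σ_{Y : Y_j = (e x′).2} ‖kernel V m Y‖`.
[cite: Salmhofer1999, Def. 2.19 (2.102)-(2.106)] -/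
theorem sum_pinned_norm_kernel_glue_eq (e : Γ' ≃ ι × Γ) (Fe : ι → (Γ → 𝕜) →ₗ[𝕜] (Γ' → 𝕜))
    (hFe : ∀ β v X', Fe β v X' = if (e X').1 = β then v (e X').2 else 0) (V : GrassmannAlgebra 𝕜 Γ) {m : ℕ} (j : Fin m) (x' : Γ') :
    ∑ Y' ∈ univ.filter (fun Y' : Fin m → Γ' => Y' j = x'), ‖kernel 𝕜 (∑ β, ExteriorAlgebra.map (Fe β) V) m Y'‖ =
      ∑ Y ∈ univ.filter (fun Y : Fin m → Γ => Y j = (e x').2), ‖kernel 𝕜 V m Y‖ := by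
  classical
  rw [sum_pinned_kernel_copies_sum e Fe hFe V j x' (fun _ k => ‖k‖) (fun _ => norm_zero)]

/-- **Far pinned profiles of the glued element** (a leg `i` at coarse distance `≥ R` from the pin, read through `e`): equal to the far profile of one copy. [folklore] -/
theorem sum_pinned_far_norm_kernel_glue_eq (e : Γ' ≃ ι × Γ) (Fe : ι → (Γ → 𝕜) →ₗ[𝕜] (Γ' → 𝕜))
    (hFe : ∀ β v X', Fe β v X' = if (e X').1 = β then v (e X').2 else 0) (Far : Γ → Γ → Prop) [DecidableRel Far]
    (V : GrassmannAlgebra 𝕜 Γ) {m : ℕ} (j i : Fin m) (x' : Γ') :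
    ∑ Y' ∈ univ.filter (fun Y' : Fin m → Γ' => Y' j = x' ∧ Far (e (Y' j)).2 (e (Y' i)).2),
        ‖kernel 𝕜 (∑ β, ExteriorAlgebra.map (Fe β) V) m Y'‖ =
      ∑ Y ∈ univ.filter (fun Y : Fin m → Γ => Y j = (e x').2 ∧ Far (Y j) (Y i)), ‖kernel 𝕜 V m Y‖ := by
  classical
  have h := sum_pinned_kernel_copies_sum e Fe hFe V j x' (fun Y' k => if Far (e (Y' j)).2 (e (Y' i)).2 then ‖k‖ else 0)
    (fun Y' => by simp)
  have hL : ∑ Y' ∈ univ.filter (fun Y' : Fin m → Γ' => Y' j = x' ∧ Far (e (Y' j)).2 (e (Y' i)).2),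
        ‖kernel 𝕜 (∑ β, ExteriorAlgebra.map (Fe β) V) m Y'‖ =
      ∑ Y' ∈ univ.filter (fun Y' : Fin m → Γ' => Y' j = x'),
        (if Far (e (Y' j)).2 (e (Y' i)).2 then ‖kernel 𝕜 (∑ β, ExteriorAlgebra.map (Fe β) V) m Y'‖ else 0) := by
    rw [← sum_filter, filter_filter]
  have hR : ∑ Y ∈ univ.filter (fun Y : Fin m → Γ => Y j = (e x').2 ∧ Far (Y j) (Y i)), ‖kernel 𝕜 V m Y‖ =
      ∑ Y ∈ univ.filter (fun Y : Fin m → Γ => Y j = (e x').2), (if Far (Y j) (Y i) then ‖kernel 𝕜 V m Y‖ else 0) := by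
    rw [← sum_filter, filter_filter]
  rw [hL, hR]
  simpa only [Equiv.apply_symm_apply] using h

/-! ## §3 Profiles of differences -/

omit [Fintype ι] [DecidableEq ι] [Fintype Γ] [DecidableEq Γ] in
/-- **The weighted pinned profile of a difference is at most the sum of the profiles.** [folklore] -/
theorem sum_pinned_wt_norm_kernel_sub_le (A B : GrassmannAlgebra 𝕜 Γ') {m : ℕ} (j : Fin m) (x' : Γ') (wt : Finset Γ' → ℝ)
    (hwt : ∀ S, 0 ≤ wt S) {NA NB : ℝ}
    (hA : ∑ Y' ∈ univ.filter (fun Y' : Fin m → Γ' => Y' j = x'), ‖kernel 𝕜 A m Y'‖ * wt (univ.image Y') ≤ NA)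
    (hB : ∑ Y' ∈ univ.filter (fun Y' : Fin m → Γ' => Y' j = x'), ‖kernel 𝕜 B m Y'‖ * wt (univ.image Y') ≤ NB) :
    ∑ Y' ∈ univ.filter (fun Y' : Fin m → Γ' => Y' j = x'), ‖kernel 𝕜 (A - B) m Y'‖ * wt (univ.image Y') ≤ NA + NB := by
  have hsub : ∀ Y' : Fin m → Γ', kernel 𝕜 (A - B) m Y' = kernel 𝕜 A m Y' - kernel 𝕜 B m Y' := fun Y' => by
    rw [sub_eq_add_neg, kernel_add, ← neg_one_smul 𝕜 B, kernel_smul, neg_one_mul, ← sub_eq_add_neg]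
  calc ∑ Y' ∈ univ.filter (fun Y' : Fin m → Γ' => Y' j = x'), ‖kernel 𝕜 (A - B) m Y'‖ * wt (univ.image Y')
      ≤ ∑ Y' ∈ univ.filter (fun Y' : Fin m → Γ' => Y' j = x'),
          (‖kernel 𝕜 A m Y'‖ * wt (univ.image Y') + ‖kernel 𝕜 B m Y'‖ * wt (univ.image Y')) :=
        sum_le_sum fun Y' _ => by
          rw [hsub, ← add_mul]
          exact mul_le_mul_of_nonneg_right (norm_sub_le _ _) (hwt _)
    _ ≤ NA + NB := by rw [sum_add_distrib]; exact add_le_add hA hB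

omit [Fintype ι] [DecidableEq ι] [Fintype Γ] [DecidableEq Γ] in
/-- Unweighted twin: the pinned profile of a difference is at most the sum of the profiles. [folklore] -/
theorem sum_pinned_norm_kernel_sub_le (A B : GrassmannAlgebra 𝕜 Γ') {m : ℕ} (j : Fin m) (x' : Γ') {NA NB : ℝ}
    (hA : ∑ Y' ∈ univ.filter (fun Y' : Fin m → Γ' => Y' j = x'), ‖kernel 𝕜 A m Y'‖ ≤ NA)
    (hB : ∑ Y' ∈ univ.filter (fun Y' : Fin m → Γ' => Y' j = x'), ‖kernel 𝕜 B m Y'‖ ≤ NB) :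
    ∑ Y' ∈ univ.filter (fun Y' : Fin m → Γ' => Y' j = x'), ‖kernel 𝕜 (A - B) m Y'‖ ≤ NA + NB := by
  have h := sum_pinned_wt_norm_kernel_sub_le A B j x' (fun _ => (1 : ℝ)) (fun _ => zero_le_one) (NA := NA) (NB := NB)
    (by simpa using hA) (by simpa using hB)
  simpa using h

end Summit.HubbardSuperconductivity.HubbardSuperconductivity.Theorems.TwoVolumeDefect

end
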